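import Summits.QuantumFields.BalabanUV.Beta.D1BFx.PackedColumnEnvelope
import Summits.QuantumFields.BalabanUV.Beta.AxialDressingRootedSupport

/-!
# `BalabanUV.Beta.D1BFx.AxialRibbon` — road «BF-x» for binder row D1, slot (K), PART 24 letter **L-h♭, PART A (GENERIC): «INSIDE A BLOCK, A 1-FORM IN ROOTED AXIAL GAUGE
# IS A RIBBON OF ITS PLAQUETTES»** — for ANY 1-form `A`, root `y`, point `x` and axis `κ`,
# `A κ x − (A(Γ_{y, x + e_κ}) − A(Γ_{y, x})) = Σ_{tail of Γ_{y,x} below axis κ} (±)[(A κ (p + e_m) − A κ p) − (A m (p + e_κ) − A m p)]`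
# (the two axial contours share the segments above axis `κ`, differ by ONE letter on it and by the `e_κ`-SHIFT of the tail below it) — at most `(d+1)·N` PLAQUETTE letters, each a
# difference of two UNIT DIFFERENCES of `A`; hence for the co-dressed column of ANY packed kernel `K` (`colH (coDressKBmAt (toSite r) N K) N μ y = colH K N μ y − d(χ_r)`,
# `GAN24/CoDressedColumnPairing.colH_coDressKBmAt_eq_sub_grad`; the block means cancel inside a block): **`|colH (coDressKBmAt (toSite r) N K) N μ y κ u| ≤ (d+1)·N·2G` on every
# bond INSIDE a block, `G` = a blockwise unit-difference bound of the straight column** — and the pure gauge `dχ_r`: `≤ M + (d+1)N·2G` inside, `≤ 2(d+1)N·M·(1 + e^{c})` on every bond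

HONEST DEPENDENCY (cell records, verbatim): «continuum YM on T⁴ ⇐ BetaPertH ∧ nine spine estimates (0/9 proved); BetaPertH ⇐ (D1) ∧ (D4) ∧
CAP+tail; G-an2-4 gates asym, D1 and NE2/3/4.»  HONEST FRAMING (cell contract, verbatim): «discharging `BetaPertH` makes Bałaban's UV stability
UNCONDITIONAL — a real constructive-QFT result; it is NOT the continuum limit and NOT the Clay problem.»  THIS MODULE is [folklore] lattice-path bookkeeping over
lit-balaban's axial-contour API (`AveragingContours`: `seg ∕ corner ∕ axialAux ∕ axial ∕ axialAux_sum_grad ∕ axialAux_sum_sub ∕ seg_add ∕ corner_succ_add`; `treeGaugeAt`), an2's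
`AxialDressingRooted(Support)` (`axial_length_le_of_root`) ∕ `AxialProjectorBlockMean` (`bmGaugeAt ∕ blockMeanAt`), gan24's `CoDressedColumnPairing.colH_coDressKBmAt_eq_sub_grad` ∕
`DressedLegEnvelope.blk_eq_of_mem_axial ∕ abs_bmGaugeAt_le_of_blockwise` ∕ `RespStepBmDecompExact.abs_list_sum_le` ∕ `EnvelopeBlockSum.env_wobble`, g53's
`PackedColumnEnvelope.l1_unitVec_eq_one` — all BY NAME; `A`, `K`, `G`, `M` below are ARBITRARY; no `def`, no `def … : Prop`, nothing cited, NO printed hypothesis, 0 sorry.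
WHAT IT IS: the generic half of the OWNER d1-p2 g23's RESHAPED commission C-g23-1 = L-h♭ (F-g23-1 ∕ E-g23-1 journal l.49298, N-g23-2 l.49349); the one-shot instance
(`K := KInvStep d N 0` with L-h PART 1) is PART B `D1BFx/DressedColumnRibbon`.  WHAT IT IS NOT: NOT a (1.22) row; NOT a (K)-architecture choice; 0 root-level binders of row D1
discharged (hW ∕ hR-sockets ∕ hSX-socket ∕ D1Tel ∕ D1Rep = 0); (K) NOT closed; NOT D1, NOT `BetaPertH`, NOT continuum, NOT Clay.
ABSOLUTE RULE (cell charter, verbatim): «No internally-minted statement may enter as a cited fact. Every hypothesis is either kernel-proved in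
this package or a verbatim quotation of a PUBLISHED theorem with page reference. The manuscript(s) under audit are NOT citable for their own
disputed steps — they are the thing under adjudication; programme-internal (2001/route/tribunal) claims are never citable.»

CONTENT.  §1 (any dimension `D`, any additive group) [folklore]: `seg_sum_add_one` (one more bond on an axis adds its letter), `axialAux_add_unitVec_of_le` (below axis `κ` the contour
to `x + e_κ` is the `e_κ`-shift of the contour to `x`), `corner_add_unitVec_of_lt` ∕ `axialAux_sum_add_unitVec_sub` (above axis `κ` the two contours coincide; on it they differ by the one
letter `A κ (corner y x κ)`), **`sub_axial_sub_axial_eq_ribbon`** — THE RIBBON IDENTITY, `axialAux_suffix(_axial)` (the tail is a suffix of the contour).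
§2 (dimension `d + 1`, `ℝ`) [folklore]: **`abs_sub_treeGaugeAt_sub_le`** — in-block root, `blk N (x + e_κ) = blk N x`, blockwise unit-difference bound `G` on the block of `x` ⟹
`|A κ x − (treeGaugeAt ρ A N (x + e_κ) − treeGaugeAt ρ A N x)| ≤ ((d+1)·N)·(2G)`; `blockMeanAt_eq_of_blk_eq`, `bmGaugeAt_sub_of_blk_eq`; **`abs_colH_coDressKBmAt_interior_le`** (the
interior entry of a co-dressed column, ANY `K`); **`abs_grad_bmGaugeAt_interior_le`** (`dχ_r` inside) ∕ **`abs_grad_bmGaugeAt_le`** (`dχ_r` on every bond, faces included — g53 §1's two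
lines, isolated).  Unit `b2b-balaban-beta-d1-formalise-leaf-01` (gen 29), D1 formalisation swarm LEAF PROVER 01, road «BF-x»; COMMISSION C-g23-1 RESHAPED (OWNER d1-p2 g23);
INTENT «L-h♭ PART A» (journal).  Not in print; our bookkeeping.  No existing file touched.
-/

noncomputable section

namespace Summit.QuantumFields.BalabanUV.Beta.D1BFx.AxialRibbon

open Finset
open scoped BigOperators
open Literature.MathematicalPhysics.QuantumFieldTheory
open Literature.MathematicalPhysics.QuantumFieldTheory.LatticeForm (quo)
open Literature.MathematicalPhysics.QuantumFieldTheory.Balaban1983to89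
open Literature.MathematicalPhysics.QuantumFieldTheory.Balaban1983to89.Beta
open B4ContourShift (supNorm)
open ExpKernelCalculus (MKer)
open AffineAveraging (Form0 Form1 Site box toSite unitVec unitVec_apply)
open AveragingContours (grad shift seg segUp segDown segUp_succ segDown_succ seg_add corner corner_succ_add axialAux axial axialAux_sum_grad
  axialAux_sum_sub blk blk_block)
open AveragingContoursRooted (treeGaugeAt)
open OneStepResolventKernel (Fib)
open OneStepKernelFamily (colH)
open Summit.QuantumFields.BalabanUV.Beta.AxialDressingRooted (coDressKBmAt axial_length_le_of_root)
open Summit.QuantumFields.BalabanUV.Beta.AxialProjectorBlockMean (blockMeanAt bmGaugeAt)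
open Summit.QuantumFields.BalabanUV.Beta.GAN24.CoDressedColumnPairing (colH_coDressKBmAt_eq_sub_grad)
open Summit.QuantumFields.BalabanUV.Beta.GAN24.DressedLegEnvelope (blk_eq_of_mem_axial abs_bmGaugeAt_le_of_blockwise)
open Summit.QuantumFields.BalabanUV.Beta.GAN24.RespStepBmDecompExact (abs_list_sum_le)
open Summit.QuantumFields.BalabanUV.Beta.GAN24.EnvelopeBlockSum (env_wobble)
open Summit.QuantumFields.BalabanUV.Beta.D1BFx.PackedColumnEnvelope (l1_unitVec_eq_one)

/-! ## §1 The ribbon identity (any dimension, any additive group) -/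

section Ribbon

variable {D : ℕ} {R : Type*} [AddCommGroup R]

/-- [folklore] **ONE MORE BOND ON AN AXIS ADDS ITS LETTER**: `Σ seg A z κ (ℓ + 1) = Σ seg A z κ ℓ + A κ (z + ℓ•e_κ)` for every `ℓ : ℤ` (forward: the new last letter;
backward: the dropped last letter `−A κ (z + ℓ•e_κ)` of the longer downward segment). -/
theorem seg_sum_add_one (A : Form1 D R) (z : Site D) (κ : Fin D) (ℓ : ℤ) :
    (seg A z κ (ℓ + 1)).sum = (seg A z κ ℓ).sum + A κ (z + ℓ • unitVec κ) := by
  unfold AveragingContours.seg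
  by_cases h0 : 0 ≤ ℓ
  · obtain ⟨k, rfl⟩ := Int.eq_ofNat_of_zero_le h0
    have h1 : (0 : ℤ) ≤ (k : ℤ) + 1 := by positivity
    rw [if_pos h1, if_pos h0, show ((k : ℤ) + 1).toNat = k + 1 from by omega, Int.toNat_natCast, segUp_succ, List.sum_append,
      List.sum_singleton]
  · rw [not_le] at h0
    by_cases h1 : 0 ≤ ℓ + 1
    · have hℓ : ℓ = -1 := by omega
      subst hℓ
      rw [if_pos h1, if_neg (by norm_num), show ((-1 : ℤ) + 1).toNat = 0 from rfl, show (-(-1 : ℤ)).toNat = 0 + 1 from rfl,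
        AveragingContours.segUp_zero, segDown_succ, AveragingContours.segDown_zero, List.nil_append, List.sum_nil, List.sum_singleton,
        Nat.cast_zero, zero_add, one_smul, neg_one_zsmul, sub_eq_add_neg, neg_add_cancel]
    · rw [not_le] at h1
      obtain ⟨k, hk⟩ : ∃ k : ℕ, ℓ = -((k : ℤ) + 2) := ⟨(-ℓ - 2).toNat, by omega⟩
      have e1 : (-(ℓ + 1)).toNat = k + 1 := by omega
      have e2 : (-ℓ).toNat = (k + 1) + 1 := by omega
      rw [if_neg (not_le.mpr h1), if_neg (not_le.mpr h0), e1, e2, segDown_succ A z κ (k + 1), List.sum_append, List.sum_singleton]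
      have e3 : z - ((((k + 1 : ℕ) : ℤ)) + 1) • unitVec κ = z + ℓ • unitVec κ := by
        rw [hk, neg_smul, sub_eq_add_neg]
        congr 2
      rw [e3, neg_add_cancel_right]

/-- [folklore] **BELOW AXIS `κ` THE CONTOUR TO `x + e_κ` IS THE `e_κ`-SHIFT OF THE CONTOUR TO `x`**: for `m ≤ κ`, `axialAux A y (x + e_κ) m = axialAux (shift e_κ A) y x m`
(the corners at levels `≤ κ` carry `x`'s `κ`-coordinate, the segment lengths on axes `< κ` do not see it; `seg_add`). -/
theorem axialAux_add_unitVec_of_le (A : Form1 D R) (y x : Site D) (κ : Fin D) :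
    ∀ m : ℕ, m ≤ (κ : ℕ) → axialAux A y (x + unitVec κ) m = axialAux (shift (unitVec κ) A) y x m
  | 0, _ => rfl
  | m + 1, hm => by
    have hmD : m < D := lt_of_lt_of_le (Nat.lt_of_succ_le hm) (le_of_lt κ.isLt)
    have hne : (⟨m, hmD⟩ : Fin D) ≠ κ := fun h => by
      have h' := congrArg Fin.val h
      simp only at h'
      omega
    have hc : corner y (x + unitVec κ) (m + 1) = corner y x (m + 1) + unitVec κ := by
      funext j
      simp only [corner, Pi.add_apply, unitVec_apply]
      by_cases hj : m + 1 ≤ (j : ℕ)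
      · simp [hj]
      · have hjκ : j ≠ κ := fun h => hj (by rw [h]; exact hm)
        simp [hj, hjκ]
    have hlen : (x + unitVec κ) ⟨m, hmD⟩ - y ⟨m, hmD⟩ = x ⟨m, hmD⟩ - y ⟨m, hmD⟩ := by
      simp only [Pi.add_apply, unitVec_apply, if_neg hne, add_zero]
    simp only [axialAux, dif_pos hmD]
    rw [axialAux_add_unitVec_of_le A y x κ m (Nat.le_of_succ_le hm), hc, hlen, seg_add]

/-- [folklore] ABOVE AXIS `κ` THE CORNERS DO NOT SEE `e_κ`: for `κ < m`, `corner y (x + e_κ) m = corner y x m` (coordinate `κ` is still `y_κ` there). -/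
theorem corner_add_unitVec_of_lt (y x : Site D) (κ : Fin D) {m : ℕ} (hm : (κ : ℕ) < m) :
    corner y (x + unitVec κ) m = corner y x m := by
  funext j
  simp only [corner, Pi.add_apply, unitVec_apply]
  by_cases hj : m ≤ (j : ℕ)
  · have hjκ : j ≠ κ := fun h => by rw [h] at hj; omega
    simp [hj, hjκ]
  · simp [hj]

/-- [folklore] **ON AXIS `κ` ONE EXTRA LETTER, ABOVE IT NOTHING**: for `κ + 1 ≤ m ≤ D`,
`Σ axialAux A y (x + e_κ) m − Σ axialAux A y x m = A κ (corner y x κ) + (Σ axialAux (shift e_κ A) y x κ − Σ axialAux A y x κ)`. -/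
theorem axialAux_sum_add_unitVec_sub (A : Form1 D R) (y x : Site D) (κ : Fin D) :
    ∀ k : ℕ, (κ : ℕ) + 1 + k ≤ D →
      (axialAux A y (x + unitVec κ) ((κ : ℕ) + 1 + k)).sum - (axialAux A y x ((κ : ℕ) + 1 + k)).sum
        = A κ (corner y x κ) + ((axialAux (shift (unitVec κ) A) y x κ).sum - (axialAux A y x κ).sum)
  | 0, _ => by
    -- level `κ + 1`: the segment on axis `κ` from the common corner `c₀ := corner y x (κ+1)`, one bond longer for `x + e_κ`
    have hκ : (κ : ℕ) < D := κ.isLt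
    have hfin : (⟨(κ : ℕ), hκ⟩ : Fin D) = κ := Fin.eta κ hκ
    have hc : corner y (x + unitVec κ) ((κ : ℕ) + 1) = corner y x ((κ : ℕ) + 1) :=
      corner_add_unitVec_of_lt y x κ (Nat.lt_succ_self _)
    have hlen : (x + unitVec κ) κ - y κ = (x κ - y κ) + 1 := by
      simp only [Pi.add_apply, unitVec_apply, if_true]
      ring
    have hcorner : corner y x ((κ : ℕ) + 1) + (x κ - y κ) • unitVec κ = corner y x κ := by
      have h := corner_succ_add y x (κ : ℕ) hκ
      rw [hfin] at h
      exact h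
    show (axialAux A y (x + unitVec κ) ((κ : ℕ) + 1)).sum - (axialAux A y x ((κ : ℕ) + 1)).sum = _
    simp only [axialAux, dif_pos hκ, hfin, List.sum_append]
    rw [axialAux_add_unitVec_of_le A y x κ κ le_rfl, hc, hlen, seg_sum_add_one, hcorner]
    abel
  | k + 1, hk => by
    -- level `κ + 1 + (k+1) = (κ + 1 + k) + 1 > κ + 1`: the segment on axis `κ + 1 + k ≠ κ` is common
    have hmD : (κ : ℕ) + 1 + k < D := by omega
    have hne : (⟨(κ : ℕ) + 1 + k, hmD⟩ : Fin D) ≠ κ := fun h => by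
      have h' := congrArg Fin.val h
      simp only at h'
      omega
    have hc : corner y (x + unitVec κ) ((κ : ℕ) + 1 + k + 1) = corner y x ((κ : ℕ) + 1 + k + 1) :=
      corner_add_unitVec_of_lt y x κ (by omega)
    have hlen : (x + unitVec κ) ⟨(κ : ℕ) + 1 + k, hmD⟩ - y ⟨(κ : ℕ) + 1 + k, hmD⟩ = x ⟨(κ : ℕ) + 1 + k, hmD⟩ - y ⟨(κ : ℕ) + 1 + k, hmD⟩ := by
      simp only [Pi.add_apply, unitVec_apply, if_neg hne, add_zero]
    have ih := axialAux_sum_add_unitVec_sub A y x κ k (by omega)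
    show (axialAux A y (x + unitVec κ) ((κ : ℕ) + 1 + k + 1)).sum - (axialAux A y x ((κ : ℕ) + 1 + k + 1)).sum = _
    simp only [axialAux, dif_pos hmD, List.sum_append]
    rw [hc, hlen, ← ih]
    abel

/-- [folklore] **THE RIBBON IDENTITY.**  For every 1-form `A`, root `y`, point `x` and axis `κ`:
`A κ x − (A(Γ_{y, x + e_κ}) − A(Γ_{y, x})) = Σ axialAux F y x κ` with the PLAQUETTE form `F m p := (A κ (p + e_m) − A κ p) − (A m (p + e_κ) − A m p)` — the contours to
`x + e_κ` and to `x` share the segments above axis `κ`, differ by the one letter `A κ (corner y x κ)` on it and by the `e_κ`-shift of the tail below it; `A κ x − A κ (corner y x κ)`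
telescopes along the same tail (`axialAux_sum_grad` at `f := A κ`), and `axialAux_sum_sub` collects the two tails letter by letter. -/
theorem sub_axial_sub_axial_eq_ribbon (A : Form1 D R) (y x : Site D) (κ : Fin D) :
    A κ x - ((axial A y (x + unitVec κ)).sum - (axial A y x).sum)
      = (axialAux (grad (A κ) - (shift (unitVec κ) A - A)) y x κ).sum := by
  have hD : (κ : ℕ) + 1 + (D - ((κ : ℕ) + 1)) = D := by have := κ.isLt; omega
  have h := axialAux_sum_add_unitVec_sub A y x κ (D - ((κ : ℕ) + 1)) (le_of_eq hD)
  rw [hD] at h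
  rw [axial, axial, h, axialAux_sum_sub, axialAux_sum_sub, axialAux_sum_grad (A κ) y x κ (le_of_lt κ.isLt)]
  abel

omit [AddCommGroup R] in
/-- [folklore] THE TAIL IS A SUFFIX OF THE CONTOUR: `axialAux A y x m <:+ axialAux A y x (m + k)`. -/
theorem axialAux_suffix [AddCommGroup R] (A : Form1 D R) (y x : Site D) (m : ℕ) : ∀ k : ℕ, axialAux A y x m <:+ axialAux A y x (m + k)
  | 0 => List.suffix_refl _
  | k + 1 => by
    show axialAux A y x m <:+ axialAux A y x (m + k + 1)
    simp only [axialAux]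
    exact (axialAux_suffix A y x m k).trans (List.suffix_append _ _)

omit [AddCommGroup R] in
/-- [folklore] … in particular of the full contour `Γ_{y,x} = axialAux A y x D`. -/
theorem axialAux_suffix_axial [AddCommGroup R] (A : Form1 D R) (y x : Site D) (κ : Fin D) : axialAux A y x κ <:+ axial A y x := by
  have hD : (κ : ℕ) + (D - (κ : ℕ)) = D := by have := κ.isLt; omega
  have h := axialAux_suffix A y x κ (D - (κ : ℕ))
  rw [hD] at h
  exact h

end Ribbon

/-! ## §2 Bounds: the interior entry of a co-dressed column and the pure gauge `dχ_r` (dimension `d + 1`, real letters) -/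

section Bounds

variable {d : ℕ}

/-- [folklore] **THE RIBBON BOUND FOR THE ROOTED TREE GAUGE INSIDE A BLOCK.**  In-block root `ρ = toSite r`, `r ∈ box (d+1) N`, a bond `(κ, x)` with BOTH endpoints in one block
(`blk N (x + e_κ) = blk N x`), and a blockwise unit-difference bound on the block of `x` (`|A κ′ (w + e_ρ′) − A κ′ w| ≤ G` whenever `blk N w = blk N x`) give
`|A κ x − (treeGaugeAt ρ A N (x + e_κ) − treeGaugeAt ρ A N x)| ≤ ((d+1)·N)·(2G)` — the `≤ (d+1)N` plaquette letters of §1's ribbon all sit in the block of `x`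
(`blk_eq_of_mem_axial` on the suffix, `axial_length_le_of_root`). -/
theorem abs_sub_treeGaugeAt_sub_le {N : ℕ} (hN : 1 ≤ N) {r : Fin (d + 1) → ℕ} (hr : r ∈ box (d + 1) N) (A : Form1 (d + 1) ℝ) (x : Site (d + 1))
    (κ : Fin (d + 1)) (hblk : blk N (x + unitVec κ) = blk N x) {G : ℝ}
    (hG : ∀ (κ' ρ' : Fin (d + 1)) (w : Site (d + 1)), blk N w = blk N x → |A κ' (w + unitVec ρ') - A κ' w| ≤ G) :
    |A κ x - (treeGaugeAt (toSite r) A N (x + unitVec κ) - treeGaugeAt (toSite r) A N x)| ≤ (((d : ℝ) + 1) * N) * (2 * G) := by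
  have hG0 : 0 ≤ G := (abs_nonneg _).trans (hG 0 0 x rfl)
  unfold treeGaugeAt
  rw [hblk, sub_axial_sub_axial_eq_ribbon]
  set F : Form1 (d + 1) ℝ := grad (A κ) - (shift (unitVec κ) A - A) with hF
  set Rt : Site (d + 1) := (N : ℤ) • blk N x + toSite r with hRt
  have hsuf := axialAux_suffix_axial F Rt x κ
  have hletter : ∀ a ∈ axialAux F Rt x κ, |a| ≤ 2 * G := by
    intro a ha
    obtain ⟨κ', z', e, hz⟩ := blk_eq_of_mem_axial hN hr (hsuf.subset ha)
    have hval : |F κ' z'| ≤ 2 * G := by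
      have h1 := hG κ κ' z' hz
      have h2 := hG κ' κ z' hz
      have eF : F κ' z' = (A κ (z' + unitVec κ') - A κ z') - (A κ' (z' + unitVec κ) - A κ' z') := rfl
      rw [eF]
      calc |(A κ (z' + unitVec κ') - A κ z') - (A κ' (z' + unitVec κ) - A κ' z')|
          ≤ |A κ (z' + unitVec κ') - A κ z'| + |A κ' (z' + unitVec κ) - A κ' z'| := abs_sub _ _
        _ ≤ G + G := add_le_add h1 h2
        _ = 2 * G := by ring
    rcases e with e | e
    · rw [e]; exact hval
    · rw [e, abs_neg]; exact hval
  have hlen : ((axialAux F Rt x κ).length : ℝ) ≤ ((d : ℝ) + 1) * N := by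
    have h1 : (axialAux F Rt x κ).length ≤ (axial F Rt x).length := hsuf.length_le
    have h2 := axial_length_le_of_root hN hr F x
    have h3 : ((axialAux F Rt x κ).length : ℝ) ≤ (((d + 1) * N : ℕ) : ℝ) := by exact_mod_cast h1.trans h2
    refine h3.trans (le_of_eq ?_)
    push_cast
    ring
  exact (abs_list_sum_le hletter).trans (mul_le_mul_of_nonneg_right hlen (by positivity))

/-- [folklore] The block mean reads only the block label: `blk N x′ = blk N x → blockMeanAt N f x′ = blockMeanAt N f x`. -/
theorem blockMeanAt_eq_of_blk_eq (N : ℕ) (f : Form0 (d + 1) ℝ) {x x' : Site (d + 1)} (h : blk N x' = blk N x) :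
    blockMeanAt N f x' = blockMeanAt N f x := by
  unfold blockMeanAt
  rw [h]

/-- [folklore] **THE PURE GAUGE INSIDE A BLOCK IS A TREE-GAUGE DIFFERENCE**: for `blk N (x + e_κ) = blk N x`,
`bmGaugeAt ρ A N (x + e_κ) − bmGaugeAt ρ A N x = treeGaugeAt ρ A N (x + e_κ) − treeGaugeAt ρ A N x` (the block means cancel). -/
theorem bmGaugeAt_sub_of_blk_eq (ρ : Site (d + 1)) (A : Form1 (d + 1) ℝ) (N : ℕ) (x : Site (d + 1)) (κ : Fin (d + 1))
    (hblk : blk N (x + unitVec κ) = blk N x) :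
    bmGaugeAt ρ A N (x + unitVec κ) - bmGaugeAt ρ A N x = treeGaugeAt ρ A N (x + unitVec κ) - treeGaugeAt ρ A N x := by
  unfold bmGaugeAt
  simp only [Pi.sub_apply]
  rw [blockMeanAt_eq_of_blk_eq N _ hblk]
  ring

/-- [folklore] **THE INTERIOR ENTRY OF A CO-DRESSED COLUMN** (ANY packed kernel `K`): on a bond `(κ, u)` inside a block, a blockwise unit-difference bound `G` on the straight
column `colH K N μ y` over the block of `u` gives `|colH (coDressKBmAt (toSite r) N K) N μ y κ u| ≤ ((d+1)·N)·(2G)` (`colH_coDressKBmAt_eq_sub_grad` + the block means cancelling +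
`abs_sub_treeGaugeAt_sub_le`). -/
theorem abs_colH_coDressKBmAt_interior_le {N : ℕ} (hN : 1 ≤ N) {r : Fin (d + 1) → ℕ} (hr : r ∈ box (d + 1) N) (K : MKer (d + 1) (Fib d))
    (μ : Fin (d + 1)) (y : Site (d + 1)) (κ : Fin (d + 1)) (u : Site (d + 1)) (hblk : blk N (u + unitVec κ) = blk N u) {G : ℝ}
    (hG : ∀ (κ' ρ' : Fin (d + 1)) (w : Site (d + 1)), blk N w = blk N u → |colH K N μ y κ' (w + unitVec ρ') - colH K N μ y κ' w| ≤ G) :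
    |colH (coDressKBmAt (toSite r) N K) N μ y κ u| ≤ (((d : ℝ) + 1) * N) * (2 * G) := by
  rw [colH_coDressKBmAt_eq_sub_grad hN hr K μ y κ u, bmGaugeAt_sub_of_blk_eq _ _ N u κ hblk]
  exact abs_sub_treeGaugeAt_sub_le hN hr (colH K N μ y) u κ hblk hG

/-- [folklore] **THE PURE GAUGE `dχ_r` INSIDE A BLOCK**: with a column envelope `|colH K N μ y κ′ w| ≤ M` and the unit-difference bound `G` on the block of `u`,
`|χ (u + e_κ) − χ u| ≤ M + ((d+1)·N)·(2G)` for `χ := bmGaugeAt (toSite r) (colH K N μ y) N` (`dχ = A − (A − dχ)`). -/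
theorem abs_grad_bmGaugeAt_interior_le {N : ℕ} (hN : 1 ≤ N) {r : Fin (d + 1) → ℕ} (hr : r ∈ box (d + 1) N) (K : MKer (d + 1) (Fib d))
    (μ : Fin (d + 1)) (y : Site (d + 1)) (κ : Fin (d + 1)) (u : Site (d + 1)) (hblk : blk N (u + unitVec κ) = blk N u) {M G : ℝ}
    (hM : |colH K N μ y κ u| ≤ M)
    (hG : ∀ (κ' ρ' : Fin (d + 1)) (w : Site (d + 1)), blk N w = blk N u → |colH K N μ y κ' (w + unitVec ρ') - colH K N μ y κ' w| ≤ G) :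
    |bmGaugeAt (toSite r) (colH K N μ y) N (u + unitVec κ) - bmGaugeAt (toSite r) (colH K N μ y) N u| ≤ M + (((d : ℝ) + 1) * N) * (2 * G) := by
  have h := abs_sub_treeGaugeAt_sub_le hN hr (colH K N μ y) u κ hblk hG
  rw [bmGaugeAt_sub_of_blk_eq _ _ N u κ hblk]
  have e : treeGaugeAt (toSite r) (colH K N μ y) N (u + unitVec κ) - treeGaugeAt (toSite r) (colH K N μ y) N u
      = colH K N μ y κ u - (colH K N μ y κ u - (treeGaugeAt (toSite r) (colH K N μ y) N (u + unitVec κ) - treeGaugeAt (toSite r) (colH K N μ y) N u)) := by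
    ring
  rw [e]
  exact (abs_sub _ _).trans (add_le_add hM h)

/-- [folklore] **THE PURE GAUGE `dχ_r` ON EVERY BOND, FACES INCLUDED** (g53 §1's two lines, isolated): a block-scale column envelope `|colH K N μ y κ′ w| ≤ M·e^{−c‖⌊w∕N⌋ − y‖∞}`
(`M, c ≥ 0`) gives `|χ (u + e_κ) − χ u| ≤ 2(d+1)N·M·(1 + e^{c})·e^{−c‖⌊u∕N⌋ − y‖∞}` (`abs_bmGaugeAt_le_of_blockwise` at both endpoints; `env_wobble` for the shifted one). -/
theorem abs_grad_bmGaugeAt_le {N : ℕ} (hN : 1 ≤ N) {r : Fin (d + 1) → ℕ} (hr : r ∈ box (d + 1) N) (K : MKer (d + 1) (Fib d))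
    (μ : Fin (d + 1)) (y : Site (d + 1)) {M c : ℝ} (hM : 0 ≤ M) (hc : 0 ≤ c)
    (hK : ∀ κ w, |colH K N μ y κ w| ≤ M * Real.exp (-(c * supNorm (quo N w - y)))) (κ : Fin (d + 1)) (u : Site (d + 1)) :
    |bmGaugeAt (toSite r) (colH K N μ y) N (u + unitVec κ) - bmGaugeAt (toSite r) (colH K N μ y) N u|
      ≤ 2 * (((d : ℝ) + 1) * N) * M * (1 + Real.exp c) * Real.exp (-(c * supNorm (quo N u - y))) := by
  have hχ : ∀ p, |bmGaugeAt (toSite r) (colH K N μ y) N p| ≤ 2 * ((((d : ℝ) + 1) * N) * (M * Real.exp (-(c * supNorm (quo N p - y))))) := fun p =>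
    abs_bmGaugeAt_le_of_blockwise hN hr (A := colH K N μ y) (S := fun b => M * Real.exp (-(c * supNorm (b - y)))) (fun κ z => hK κ z) p
  have hEshift : Real.exp (-(c * supNorm (quo N (u + unitVec κ) - y))) ≤ Real.exp c * Real.exp (-(c * supNorm (quo N u - y))) := by
    have h := env_wobble (d := d) hN hc y u (u + unitVec κ)
    rw [add_sub_cancel_left, l1_unitVec_eq_one, mul_one] at h
    exact h
  have h2 : |bmGaugeAt (toSite r) (colH K N μ y) N (u + unitVec κ)|
      ≤ 2 * ((((d : ℝ) + 1) * N) * (M * (Real.exp c * Real.exp (-(c * supNorm (quo N u - y)))))) := (hχ (u + unitVec κ)).trans (by gcongr)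
  have h3 := hχ u
  calc |bmGaugeAt (toSite r) (colH K N μ y) N (u + unitVec κ) - bmGaugeAt (toSite r) (colH K N μ y) N u|
      ≤ |bmGaugeAt (toSite r) (colH K N μ y) N (u + unitVec κ)| + |bmGaugeAt (toSite r) (colH K N μ y) N u| := abs_sub _ _
    _ ≤ 2 * ((((d : ℝ) + 1) * N) * (M * (Real.exp c * Real.exp (-(c * supNorm (quo N u - y))))))
        + 2 * ((((d : ℝ) + 1) * N) * (M * Real.exp (-(c * supNorm (quo N u - y))))) := add_le_add h2 h3
    _ = 2 * (((d : ℝ) + 1) * N) * M * (1 + Real.exp c) * Real.exp (-(c * supNorm (quo N u - y))) := by ring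

end Bounds

end Summit.QuantumFields.BalabanUV.Beta.D1BFx.AxialRibbon

end
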